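import Mathlib
import Summits.NavierStokesRegularity.OSWSelfSimilar.SheetNSLineTorusCascadeExactHead56
import Summits.NavierStokesRegularity.OSWSelfSimilar.SheetNSLineTorusCascadeLinkCertified
import HarnessLib

/-!
# Viscous CLM on the torus (`a = 0`, `σ = 2`): the DATUM-FREE head/tail certificate with SIX exact head modes — for every `c ≥ 24ν`
# the sine cascade is unbounded at `t = log 2/ν` and NO classical solution of the MODEL PDE from `−c sin x` exists on `[0, log 2/ν]`

HONEST FRAMING (cell ns-blowup GROUP B «PROFILE SEARCH», zone Z3, row Z3-U addendum A-F2 of `HOME/profile/z3/CENSUS-Z3.md`;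
human rulings D-0035/D-0074; Z3-TWIN lineage): **1-D MODEL (viscous Constantin–Lax–Majda equation `ω_t = ω Hω + ν ω_xx` on `𝕋`,
`H = hilbertTransformCircle`); exact ODE algebra + rational arithmetic, kernel-checked end to end; not Euler, not Navier–Stokes;
«violates: none — MODEL». NO script datum: every inequality below is verified by `norm_num` on rationals.**

WHAT. Same architecture as `…KernelThirtyOne` (k₀ = 3, 31ν) and `…KernelTwentySeven` (k₀ = 4, 27ν): `unbounded_of_universal_static_base`
(p516509) with `k₀ = 6`, the six head modes in closed form (`SheetNSLineTorusCascadeExactHead`, `…ExactHead56`), and the rational instance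
`A = 713 / 50`, `λ₁ = 1/24`, `α = log(100 / 79)`, `T = log 2`, `L = 6 log(79 / 50)` (`e^{−L} = (50 / 79)^6`, `α + L/6 = T`),
`ζ_1 = 317 / 2000`, `ζ_2 = 83 / 1000`, `ζ_j = 0` otherwise (`Z = 649 / 2000`), the window `e^{−s} ∈ [1/2, 79 / 100]` cut into 10 rational pieces
(`windows24`); 60 rational inequalities close by `norm_num` (fixed point `12 ≤ 12.0107`).

* `windows24`, `base24`;
* **`unbounded_of_le_twentyFour`** — every sine cascade with `0 < ν`, `24ν ≤ c` has `k ↦ e_k(log 2/ν)` unbounded above;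
  `datum_lt_twentyFour_of_bounded` (census form);
* **`horizon_lt_log_two_of_le_twentyFour`** — PDE level: every classical `2π`-periodic solution of the MODEL PDE on `[0, T′]` with
  `ω(0,·) = −c sin`, `0 < ν`, `24ν ≤ c`, has `T′ < log 2/ν`; `datum_lt_twentyFour_of_classicalSolution` (census form).
READING: datum-free kernel sentence for sine data: «global + unique classical solution for c < 12ν (eng-3); NO classical solution on
[0, log 2/ν] for c ≥ 24ν» (48ν eng-3 → 31ν → 27ν → 24ν); located threshold `19.7756ν`; certified script+kernel bracket
`[19.7755478, 19.7766876]ν`. bears_on: LADDER-NS N5 / zone Z3 (row Z3-U) → N1 linear core. WHAT THIS IS NOT: not NS; no definitions;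
nothing numerical outside the kernel. (Lean text generated from the exact instance by `work/geninst.py`, eng-5 g11 seat folder.)
-/

namespace Summit.NavierStokesRegularity.OSWSelfSimilar
namespace SheetNSLineTorusCascade

open Finset Real Set

variable {ν c : ℝ} {e : ℕ → ℝ → ℝ}

/-! ### The window `[log(100 / 79), log 2]` in 10 pieces -/

/-- `−log(79 / 100) = log(100 / 79)`. -/
private theorem neg_log_v0_24 : -Real.log (79 / 100) = Real.log (100 / 79) := by
  rw [← Real.log_inv]; norm_num

/-- `−log(1/2) = log 2`. -/
private theorem neg_log_half_24 : -Real.log (1 / 2) = Real.log 2 := by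
  rw [← Real.log_inv]; norm_num

/-- On `[log(100 / 79), log 2]` the variable `x = e^{−s}` lies in one of 10 rational pieces of `[1/2, 79 / 100]`. -/
theorem windows24 {s : ℝ} (hs : s ∈ Icc (Real.log (100 / 79)) (Real.log 2)) :
    ((151 / 200 : ℝ) ≤ exp (-s) ∧ exp (-s) ≤ 79 / 100) ∨
    ((721 / 1000 : ℝ) ≤ exp (-s) ∧ exp (-s) ≤ 151 / 200) ∨
    ((689 / 1000 : ℝ) ≤ exp (-s) ∧ exp (-s) ≤ 721 / 1000) ∨
    ((329 / 500 : ℝ) ≤ exp (-s) ∧ exp (-s) ≤ 689 / 1000) ∨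
    ((157 / 250 : ℝ) ≤ exp (-s) ∧ exp (-s) ≤ 329 / 500) ∨
    ((3 / 5 : ℝ) ≤ exp (-s) ∧ exp (-s) ≤ 157 / 250) ∨
    ((287 / 500 : ℝ) ≤ exp (-s) ∧ exp (-s) ≤ 3 / 5) ∨
    ((137 / 250 : ℝ) ≤ exp (-s) ∧ exp (-s) ≤ 287 / 500) ∨
    ((523 / 1000 : ℝ) ≤ exp (-s) ∧ exp (-s) ≤ 137 / 250) ∨
    ((1 / 2 : ℝ) ≤ exp (-s) ∧ exp (-s) ≤ 523 / 1000) := by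
  have hhi : exp (-s) ≤ 79 / 100 :=
    exp_neg_le_of_neg_log_le (by norm_num) (by rw [neg_log_v0_24]; exact hs.1)
  have hlo : (1 / 2 : ℝ) ≤ exp (-s) := le_exp_neg_of_le_neg_log (by norm_num) (by rw [neg_log_half_24]; exact hs.2)
  rcases le_total s (-Real.log (151 / 200)) with h1 | h1
  · exact Or.inl ⟨le_exp_neg_of_le_neg_log (by norm_num) h1, hhi⟩
  rcases le_total s (-Real.log (721 / 1000)) with h2 | h2
  · exact Or.inr (Or.inl ⟨le_exp_neg_of_le_neg_log (by norm_num) h2, exp_neg_le_of_neg_log_le (by norm_num) h1⟩)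
  rcases le_total s (-Real.log (689 / 1000)) with h3 | h3
  · exact Or.inr (Or.inr (Or.inl ⟨le_exp_neg_of_le_neg_log (by norm_num) h3, exp_neg_le_of_neg_log_le (by norm_num) h2⟩))
  rcases le_total s (-Real.log (329 / 500)) with h4 | h4
  · exact Or.inr (Or.inr (Or.inr (Or.inl ⟨le_exp_neg_of_le_neg_log (by norm_num) h4, exp_neg_le_of_neg_log_le (by norm_num) h3⟩)))
  rcases le_total s (-Real.log (157 / 250)) with h5 | h5
  · exact Or.inr (Or.inr (Or.inr (Or.inr (Or.inl ⟨le_exp_neg_of_le_neg_log (by norm_num) h5, exp_neg_le_of_neg_log_le (by norm_num) h4⟩))))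
  rcases le_total s (-Real.log (3 / 5)) with h6 | h6
  · exact Or.inr (Or.inr (Or.inr (Or.inr (Or.inr (Or.inl ⟨le_exp_neg_of_le_neg_log (by norm_num) h6, exp_neg_le_of_neg_log_le (by norm_num) h5⟩)))))
  rcases le_total s (-Real.log (287 / 500)) with h7 | h7
  · exact Or.inr (Or.inr (Or.inr (Or.inr (Or.inr (Or.inr (Or.inl ⟨le_exp_neg_of_le_neg_log (by norm_num) h7, exp_neg_le_of_neg_log_le (by norm_num) h6⟩))))))
  rcases le_total s (-Real.log (137 / 250)) with h8 | h8
  · exact Or.inr (Or.inr (Or.inr (Or.inr (Or.inr (Or.inr (Or.inr (Or.inl ⟨le_exp_neg_of_le_neg_log (by norm_num) h8, exp_neg_le_of_neg_log_le (by norm_num) h7⟩)))))))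
  rcases le_total s (-Real.log (523 / 1000)) with h9 | h9
  · exact Or.inr (Or.inr (Or.inr (Or.inr (Or.inr (Or.inr (Or.inr (Or.inr (Or.inl ⟨le_exp_neg_of_le_neg_log (by norm_num) h9, exp_neg_le_of_neg_log_le (by norm_num) h8⟩))))))))
  · exact Or.inr (Or.inr (Or.inr (Or.inr (Or.inr (Or.inr (Or.inr (Or.inr (Or.inr ⟨hlo, exp_neg_le_of_neg_log_le (by norm_num) h9⟩))))))))

/-! ### The head base (`k₀ = 6`, `A = 713 / 50`, `λ₁ = 1/24`) -/

/-- **THE HEAD BASE, IN THE KERNEL.** For `j ≤ 6` and `s ∈ [log(100 / 79), log 2]`: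
`(713 / 50)·j·(1/24)^j·(1 − ζ_j) ≤ E_j(s)`. [new here — MODEL] -/
theorem base24 (j : ℕ) (hj : j ≤ 6) {s : ℝ} (hs : s ∈ Icc (Real.log (100 / 79)) (Real.log 2)) :
    (713 / 50 : ℝ) * (j : ℝ) * (1 / 24 : ℝ) ^ j * (1 - (if j = 1 then (317 / 2000 : ℝ) else if j = 2 then (83 / 1000 : ℝ) else 0))
      ≤ cascadeSolution 1 (sineDatum 1) j s := by
  have hlo : (1 / 2 : ℝ) ≤ exp (-s) := le_exp_neg_of_le_neg_log (by norm_num) (by rw [neg_log_half_24]; exact hs.2)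
  interval_cases j
  · simp
  · have h1 := univ_one_ge hlo
    have hnum : (713 / 50 : ℝ) * ((1 : ℕ) : ℝ) * (1 / 24 : ℝ) ^ 1 * (1 - (if 1 = 1 then (317 / 2000 : ℝ) else if 1 = 2 then (83 / 1000 : ℝ) else 0)) ≤ 1 / 2 := by
      norm_num
    linarith
  · have hnum : (713 / 50 : ℝ) * ((2 : ℕ) : ℝ) * (1 / 24 : ℝ) ^ 2 * (1 - (if 2 = 1 then (317 / 2000 : ℝ) else if 2 = 2 then (83 / 1000 : ℝ) else 0))
        ≤ 454043 / 10000000 := by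
      norm_num
    refine le_trans hnum ?_
    rcases windows24 hs with ⟨hb, ha⟩ | ⟨hb, ha⟩ | ⟨hb, ha⟩ | ⟨hb, ha⟩ | ⟨hb, ha⟩ | ⟨hb, ha⟩ | ⟨hb, ha⟩ | ⟨hb, ha⟩ | ⟨hb, ha⟩ | ⟨hb, ha⟩
    all_goals exact le_trans (by norm_num) (univ_two_ge (by norm_num) hb ha (by norm_num))
  · have hnum : (713 / 50 : ℝ) * ((3 : ℕ) : ℝ) * (1 / 24 : ℝ) ^ 3 * (1 - (if 3 = 1 then (317 / 2000 : ℝ) else if 3 = 2 then (83 / 1000 : ℝ) else 0))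
        ≤ 31 / 10000 := by
      norm_num
    refine le_trans hnum ?_
    rcases windows24 hs with ⟨hb, ha⟩ | ⟨hb, ha⟩ | ⟨hb, ha⟩ | ⟨hb, ha⟩ | ⟨hb, ha⟩ | ⟨hb, ha⟩ | ⟨hb, ha⟩ | ⟨hb, ha⟩ | ⟨hb, ha⟩ | ⟨hb, ha⟩
    all_goals exact le_trans (by norm_num) (univ_three_ge (by norm_num) hb ha (by norm_num))
  · have hnum : (713 / 50 : ℝ) * ((4 : ℕ) : ℝ) * (1 / 24 : ℝ) ^ 4 * (1 - (if 4 = 1 then (317 / 2000 : ℝ) else if 4 = 2 then (83 / 1000 : ℝ) else 0))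
        ≤ 9 / 50000 := by
      norm_num
    refine le_trans hnum ?_
    rcases windows24 hs with ⟨hb, ha⟩ | ⟨hb, ha⟩ | ⟨hb, ha⟩ | ⟨hb, ha⟩ | ⟨hb, ha⟩ | ⟨hb, ha⟩ | ⟨hb, ha⟩ | ⟨hb, ha⟩ | ⟨hb, ha⟩ | ⟨hb, ha⟩
    all_goals exact le_trans (by norm_num) (univ_four_ge (by norm_num) hb ha (by norm_num))
  · have hnum : (713 / 50 : ℝ) * ((5 : ℕ) : ℝ) * (1 / 24 : ℝ) ^ 5 * (1 - (if 5 = 1 then (317 / 2000 : ℝ) else if 5 = 2 then (83 / 1000 : ℝ) else 0))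
        ≤ 1 / 100000 := by
      norm_num
    refine le_trans hnum ?_
    rcases windows24 hs with ⟨hb, ha⟩ | ⟨hb, ha⟩ | ⟨hb, ha⟩ | ⟨hb, ha⟩ | ⟨hb, ha⟩ | ⟨hb, ha⟩ | ⟨hb, ha⟩ | ⟨hb, ha⟩ | ⟨hb, ha⟩ | ⟨hb, ha⟩
    all_goals exact le_trans (by norm_num) (univ_five_ge (by norm_num) hb ha (by norm_num))
  · have hnum : (713 / 50 : ℝ) * ((6 : ℕ) : ℝ) * (1 / 24 : ℝ) ^ 6 * (1 - (if 6 = 1 then (317 / 2000 : ℝ) else if 6 = 2 then (83 / 1000 : ℝ) else 0))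
        ≤ 1 / 2000000 := by
      norm_num
    refine le_trans hnum ?_
    rcases windows24 hs with ⟨hb, ha⟩ | ⟨hb, ha⟩ | ⟨hb, ha⟩ | ⟨hb, ha⟩ | ⟨hb, ha⟩ | ⟨hb, ha⟩ | ⟨hb, ha⟩ | ⟨hb, ha⟩ | ⟨hb, ha⟩ | ⟨hb, ha⟩
    all_goals exact le_trans (by norm_num) (univ_six_ge (by norm_num) hb ha (by norm_num))

/-! ### The datum-free theorems -/

/-- `e^{−6 log(79 / 50)} = (50 / 79)^6`. -/
private theorem exp_neg_L24 : exp (-(6 * Real.log (79 / 50))) = (50 / 79 : ℝ) ^ 6 := by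
  have h : -(6 * Real.log (79 / 50)) = ((6 : ℕ) : ℝ) * Real.log (50 / 79) := by
    rw [show (50 / 79 : ℝ) = (79 / 50)⁻¹ by norm_num, Real.log_inv]
    push_cast
    ring
  rw [h, Real.exp_nat_mul, Real.exp_log (by norm_num)]

/-- `log(100 / 79) + (6 log(79 / 50))/6 = log 2` (the window closes exactly at `T = log 2`). -/
private theorem window_end24 : Real.log (100 / 79) + 6 * Real.log (79 / 50) / ((6 : ℕ) : ℝ) = Real.log 2 := by
  have h : Real.log (100 / 79) + Real.log (79 / 50) = Real.log 2 := by
    rw [← Real.log_mul (by norm_num) (by norm_num)]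
    norm_num
  push_cast
  linarith [h]

/-- **FINITE-TIME BLOW-UP FOR `c ≥ 24ν`, DATUM-FREE (coefficient form).** For every sine cascade with `0 < ν` and `24ν ≤ c` the
sequence `k ↦ e_k(log 2/ν)` is unbounded above (head/tail certificate with `k₀ = 6`, head base `base24` verified in the kernel).
[new here — MODEL] -/
theorem unbounded_of_le_twentyFour (he : IsSineCascade ν c e) (hν : 0 < ν) (hc : 24 * ν ≤ c) :
    ∀ M : ℝ, ∃ k : ℕ, M < e k (Real.log 2 / ν) := by
  have hα : 0 ≤ Real.log (100 / 79) := Real.log_nonneg (by norm_num)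
  have hL : 0 < 6 * Real.log (79 / 50) := mul_pos (by norm_num) (Real.log_pos (by norm_num))
  have hζ0 : ∀ j : ℕ, 0 ≤ (fun j : ℕ => if j = 1 then (317 / 2000 : ℝ) else if j = 2 then (83 / 1000 : ℝ) else 0) j := by
    intro j; simp only; split_ifs <;> norm_num
  have hζ1 : ∀ j : ℕ, (fun j : ℕ => if j = 1 then (317 / 2000 : ℝ) else if j = 2 then (83 / 1000 : ℝ) else 0) j ≤ 1 := by
    intro j; simp only; split_ifs <;> norm_num
  have hζsupp : ∀ j : ℕ, 6 < j → (fun j : ℕ => if j = 1 then (317 / 2000 : ℝ) else if j = 2 then (83 / 1000 : ℝ) else 0) j = 0 := by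
    intro j hj
    have h1 : j ≠ 1 := by omega
    have h2 : j ≠ 2 := by omega
    simp [h1, h2]
  have hZ : ∀ n : ℕ, ∑ j ∈ range (n + 1), (j : ℝ) * (fun j : ℕ => if j = 1 then (317 / 2000 : ℝ) else if j = 2 then (83 / 1000 : ℝ) else 0) j
      ≤ 649 / 2000 := by
    intro n
    have hsplit : ∀ j : ℕ, (j : ℝ) * (fun j : ℕ => if j = 1 then (317 / 2000 : ℝ) else if j = 2 then (83 / 1000 : ℝ) else 0) j
        = (if j = 1 then (j : ℝ) * (317 / 2000 : ℝ) else 0) + (if j = 2 then (j : ℝ) * (83 / 1000 : ℝ) else 0) := by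
      intro j
      by_cases h1 : j = 1
      · subst h1; simp
      · by_cases h2 : j = 2
        · subst h2; simp
        · simp [h1, h2]
    simp only [hsplit, Finset.sum_add_distrib, Finset.sum_ite_eq']
    split_ifs <;> norm_num
  have hZk : 1 + 12 * (649 / 2000 : ℝ) ≤ (((6 : ℕ) : ℝ) + 1) ^ 2 := by norm_num
  have hAL : 12 ≤ (713 / 50 : ℝ) * (1 - exp (-(6 * Real.log (79 / 50))))
      * (1 - (1 + 12 * (649 / 2000 : ℝ)) / (((6 : ℕ) : ℝ) + 1) ^ 2) := by
    rw [exp_neg_L24]; norm_num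
  have hc' : ν ≤ (1 / 24 : ℝ) * c := by linarith
  have ht : Real.log 2 / ν ∈ Icc ((Real.log (100 / 79) + 6 * Real.log (79 / 50) / ((6 : ℕ) : ℝ)) / ν) (Real.log 2 / ν) := by
    rw [window_end24]
    exact ⟨le_rfl, le_rfl⟩
  exact unbounded_of_universal_static_base (by norm_num : (0 : ℝ) < 713 / 50) (by norm_num : (0 : ℝ) < 1 / 24) hα hL
    (by norm_num : 1 ≤ 6) (fun j : ℕ => if j = 1 then (317 / 2000 : ℝ) else if j = 2 then (83 / 1000 : ℝ) else 0) hζ0 hζ1 hζsupp hZ hZk hAL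
    (fun j hj s hs => base24 j hj hs) hν hc' he ht

/-- **Contrapositive (census form).** A sine cascade bounded in `k` at `t = log 2/ν` (`ν > 0`) has `c < 24ν`. [new here — MODEL] -/
theorem datum_lt_twentyFour_of_bounded (he : IsSineCascade ν c e) (hν : 0 < ν)
    (hbdd : ∃ M : ℝ, ∀ k : ℕ, e k (Real.log 2 / ν) ≤ M) : c < 24 * ν := by
  by_contra h
  obtain ⟨M, hM⟩ := hbdd
  obtain ⟨k, hk⟩ := unbounded_of_le_twentyFour he hν (not_lt.mp h) M
  exact absurd (hM k) (not_le.mpr hk)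

/-- **PDE LEVEL, DATUM-FREE: no classical `2π`-periodic solution of `ω_t = ω·Hω + ν ω_xx` from `−c sin x` with `c ≥ 24ν` exists on
`[0, log 2/ν]`** (eng-3's `horizon_lt_log_two_div`: `48ν`; this lineage: `31ν`, `27ν`, now `24ν`). [new here — MODEL] -/
theorem horizon_lt_log_two_of_le_twentyFour {T : ℝ} {ω ωt ωx ωxx : ℝ → ℝ → ℝ} (h : IsClassicalSolution ν T ω ωt ωx ωxx)
    (hω0 : ∀ x, ω 0 x = -c * Real.sin x) (hν : 0 < ν) (hc : 24 * ν ≤ c) : T < Real.log 2 / ν :=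
  horizon_lt_of_cascade_unbounded h hω0 (div_pos (Real.log_pos (by norm_num)) hν)
    fun e he => unbounded_of_le_twentyFour he hν hc

/-- **Census form at the PDE level:** a classical solution from `−c sin x` that exists on `[0, T]` with `log 2/ν ≤ T` (`ν > 0`) has
`c < 24ν`. [new here — MODEL] -/
theorem datum_lt_twentyFour_of_classicalSolution {T : ℝ} {ω ωt ωx ωxx : ℝ → ℝ → ℝ}
    (h : IsClassicalSolution ν T ω ωt ωx ωxx) (hω0 : ∀ x, ω 0 x = -c * Real.sin x) (hν : 0 < ν)
    (hT : Real.log 2 / ν ≤ T) : c < 24 * ν := by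
  by_contra hcon
  exact absurd hT (not_le.mpr (horizon_lt_log_two_of_le_twentyFour h hω0 hν (not_lt.mp hcon)))

end SheetNSLineTorusCascade
end Summit.NavierStokesRegularity.OSWSelfSimilar
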